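import Literature.MathematicalPhysics.KineticTheory.LangevinChainConfinedLaSalle
import Literature.MathematicalPhysics.KineticTheory.ConfinedControlReach
import HarnessLib

/-!
# Chains with confining potentials pulled at the left end by a constant force: LaSalle relaxation to the forced equilibrium, and irreducibility towards it

Topic `Literature/MathematicalPhysics/KineticTheory` (trunk T-KINETIC). Proof file of the provefact
unit for `CuneoEckmannHairerReyBellet2018_thm213_pureQuartic`; generic in the chain. For an
oscillator chain `P` with confining potentials (`OscillatorChain.IsConfining`) the transition
kernels `OscillatorChain.langevinKernel` are the laws of the pathwise flow `drivenFlow (P.drift N)`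
driven by the bath noise paths (model-free pipeline). `LangevinChainConfinedLaSalle.lean` proved
that the UNDRIVEN damped chain relaxes to its rest point `0` (LaSalle) and deduced the pointed
irreducibility of the kernels towards `0`. For the minorisation of the purely quartic chain
(whose linearisation at `0` is degenerate) the local small set sits at a FORCED equilibrium
`x⋆ = (q⋆, 0)`, the rest point of the chain pulled at its left end by a constant force `f`
(`∂_iΦ(q⋆) = f [i = 0]`; `PureQuarticChainForcedEquilibrium.lean`), and the small-set theorem
(`Literature/Probability/Process/SmallSets.lean`, pointed form) needs irreducibility TOWARDS `x⋆`.
This file supplies it by LaSalle's principle for the FORCED undriven chain — the flow driven by the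
ramp control `t ↦ (f t) ∂_{p_0}` (a Lipschitz control in the left bath direction), which is the
autonomous damped dynamics `ż = Y(z) + f ∂_{p_0}` with the tilted energy `H_f = H - f q_0`,
`dH_f/dt = -γ ∑_b p_b²`:

* `forceRamp`, the forced flow `drivenFlow (P.drift N) x (forceRamp N hN f)`: clamping, cocycle
  (`forcedFlow_add`: the ramp is additive), continuity, integral and differential equation;
* the tilted energy identity `H_f(φ_t x) = H_f(x) - γ∫₀ᵗ ∑ w_i p_i²` and its consequences
  (monotone, convergent, compact sublevel sets under the domination hypothesis
  `|f q_0| ≤ H/2 + C_f`, stationary at cluster points, vanishing bath momenta);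
* the component equations, **rigidity** (`forced_rest_of_momentum_last_eq_zero`): if the momentum
  of the last site vanishes along the forced orbit from `w` then `w` is a forced rest point
  (`p = 0`, `∂_iΦ(q) = 0` for `i ≠ 0`, `∂_0Φ(q) = f`), by peeling from the right with `V'`
  injective;
* **LaSalle** (`tendsto_forcedFlow`): given that the forced rest configuration is UNIQUE
  (hypothesis `huniq`, supplied by the model), every forced trajectory converges to `x⋆ = (q⋆, 0)`;
* **irreducibility towards `x⋆`** (`langevinKernel_pos_of_mem_nhds_forced`,
  `exists_langevinKernel_pos_of_forced_mem`): every neighbourhood of `x⋆` is reached from every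
  point with positive probability at all large times (support theorem for the ramp control,
  `ConfinedDrift.sdeKernel_pos_of_flow_mem`).

## References

* J. P. LaSalle, IRE Trans. Circuit Theory **7** (1960) 520–527.
* N. Cuneo, J.-P. Eckmann, M. Hairer, L. Rey-Bellet, EJP **23** (2018) no. 55, Prop. 3.3, Cor. 3.4
  (controls through the bath momenta), Prop. 3.6.
* L. Rey-Bellet, L. E. Thomas, Comm. Math. Phys. **225** (2002), Prop. 4.2 (irreducibility from
  control). [folklore]
-/

noncomputable section

open MeasureTheory ProbabilityTheory Filter Topology Set Metric
open scoped NNReal ENNReal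

namespace Literature.MathematicalPhysics.KineticTheory.HeatConduction

open Literature.MathematicalPhysics.KineticTheory Literature.Probability.Process
  Literature.Analysis.ODE

variable {N : ℕ}

/-! ### The ramp control -/

/-- The **ramp control noise path** `t ↦ (f t) ∂_{p_0}`: a constant force `f` on the momentum of
the left end, written as an additive noise path (its derivative is the constant vector `f ∂_{p_0}`).
[cite: CuneoEckmannHairerReyBellet2018, Cor 3.4] -/
def forceRamp (N : ℕ) (hN : 0 < N) (f : ℝ) : ℝ → PhaseSpace N := fun t => (f * t) • unitP ⟨0, hN⟩

section Ramp

variable (hN : 0 < N) (f : ℝ)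

/-- Unfolding the ramp. [folklore] -/
theorem forceRamp_apply (t : ℝ) : forceRamp N hN f t = (f * t) • unitP ⟨0, hN⟩ := rfl

/-- The ramp is continuous. [folklore] -/
theorem continuous_forceRamp : Continuous (forceRamp N hN f) :=
  (continuous_const.mul continuous_id).smul continuous_const

/-- The ramp has no position component. [folklore] -/
@[simp] theorem forceRamp_fst (t : ℝ) : (forceRamp N hN f t).1 = 0 := by
  simp [forceRamp, unitP]

/-- The momentum components of the ramp: `f t` at the left end, `0` elsewhere. [folklore] -/
theorem forceRamp_snd_apply (t : ℝ) (i : Fin N) :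
    (forceRamp N hN f t).2 i = if i = ⟨0, hN⟩ then f * t else 0 := by
  simp [forceRamp, unitP, Pi.single_apply]

/-- The ramp vanishes at time `0`. [folklore] -/
@[simp] theorem forceRamp_zero : forceRamp N hN f 0 = 0 := by simp [forceRamp]

/-- The ramp lies in the momentum subspace. [folklore] -/
theorem forceRamp_mem_momentumSubspace (t : ℝ) : forceRamp N hN f t ∈ momentumSubspace N :=
  mem_momentumSubspace.2 (forceRamp_fst hN f t)

/-- **The ramp is additive**: `ramp(s + r) - ramp(s) = ramp(r)` (the forced dynamics is autonomous).
[folklore] -/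
theorem forceRamp_add_sub (s r : ℝ) : forceRamp N hN f (s + r) - forceRamp N hN f s = forceRamp N hN f r := by
  simp only [forceRamp, ← sub_smul]
  congr 1
  ring

/-- The ramp has derivative `f ∂_{p_0}`. [folklore] -/
theorem hasDerivAt_forceRamp (t : ℝ) : HasDerivAt (forceRamp N hN f) (f • unitP ⟨0, hN⟩) t := by
  have h := ((hasDerivAt_id t).const_mul f).smul_const (unitP ⟨0, hN⟩ : PhaseSpace N)
  simp only [mul_one, id] at h
  exact h

end Ramp

namespace OscillatorChain

namespace IsConfining

variable {P : OscillatorChain}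

/-! ### The forced flow: basic properties -/

section Flow

variable (hP : P.IsConfining) (N : ℕ) (hN : 0 < N) (f : ℝ)
include hP

/-- The ramp lies in the noise subspace of the confined drift. [folklore] -/
theorem forceRamp_mem_noise (t : ℝ) : forceRamp N hN f t ∈ (hP.confinedDrift N).noise :=
  forceRamp_mem_momentumSubspace hN f t

/-- For `t ≤ 0` the forced flow is clamped at `x`. [folklore] -/
theorem forcedFlow_of_nonpos (x : PhaseSpace N) {t : ℝ} (ht : t ≤ 0) :
    drivenFlow (P.drift N) x (forceRamp N hN f) t = x := by
  rw [(hP.confinedDrift N).toConfinedDrift.flow_of_nonpos x (continuous_forceRamp hN f) ht]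
  simp

/-- The forced flow starts at `x`. [folklore] -/
theorem forcedFlow_zero (x : PhaseSpace N) : drivenFlow (P.drift N) x (forceRamp N hN f) 0 = x :=
  hP.forcedFlow_of_nonpos N hN f x le_rfl

/-- **The cocycle property of the forced flow**: `φ_{s+t} = φ_t ∘ φ_s` for `s, t ≥ 0` (the ramp
being additive, the forced dynamics is autonomous). [folklore] -/
theorem forcedFlow_add (x : PhaseSpace N) {s t : ℝ} (hs : 0 ≤ s) (ht : 0 ≤ t) :
    drivenFlow (P.drift N) x (forceRamp N hN f) (s + t) =
      drivenFlow (P.drift N) (drivenFlow (P.drift N) x (forceRamp N hN f) s) (forceRamp N hN f) t := by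
  have h := (hP.confinedDrift N).toConfinedDrift.flow_add x (continuous_forceRamp hN f)
    (hP.forceRamp_mem_noise N hN f) hs ht
  have e : (fun r : ℝ => forceRamp N hN f (s + r) - forceRamp N hN f s) = forceRamp N hN f :=
    funext fun r => forceRamp_add_sub hN f s r
  rw [e] at h
  exact h

/-- The forced flow is continuous in time. [folklore] -/
theorem continuous_forcedFlow (x : PhaseSpace N) : Continuous (drivenFlow (P.drift N) x (forceRamp N hN f)) :=
  (hP.confinedDrift N).toConfinedDrift.continuous_flow x (continuous_forceRamp hN f) (hP.forceRamp_mem_noise N hN f)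

/-- The forced flow is continuous in the initial condition. [folklore] -/
theorem continuous_forcedFlow_left (t : ℝ) :
    Continuous fun x : PhaseSpace N => drivenFlow (P.drift N) x (forceRamp N hN f) t :=
  (hP.confinedDrift N).toConfinedDrift.continuous_flow_left (continuous_forceRamp hN f)
    (hP.forceRamp_mem_noise N hN f) t

/-- The forced flow solves the integral equation `z(t) = x + ramp(t) + ∫₀ᵗ Y(z(s)) ds`, `t ≥ 0`.
[folklore] -/
theorem forcedFlow_eq_integral (x : PhaseSpace N) {t : ℝ} (ht : 0 ≤ t) :
    drivenFlow (P.drift N) x (forceRamp N hN f) t =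
      x + forceRamp N hN f t + ∫ s in (0 : ℝ)..t, P.drift N (drivenFlow (P.drift N) x (forceRamp N hN f) s) :=
  (hP.confinedDrift N).toConfinedDrift.isIntegralSolutionOn_flow x (continuous_forceRamp hN f)
    (hP.forceRamp_mem_noise N hN f) t t ⟨ht, le_rfl⟩

/-- **The forced flow is a classical solution**: `φ'(t) = Y(φ(t)) + f ∂_{p_0}` for `t > 0`. [folklore] -/
theorem hasDerivAt_forcedFlow (x : PhaseSpace N) {t : ℝ} (ht : 0 < t) :
    HasDerivAt (drivenFlow (P.drift N) x (forceRamp N hN f))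
      (P.drift N (drivenFlow (P.drift N) x (forceRamp N hN f) t) + f • unitP ⟨0, hN⟩) t := by
  set z := drivenFlow (P.drift N) x (forceRamp N hN f) with hz
  have hYz : Continuous fun s => P.drift N (z s) :=
    (hP.continuous_drift N).comp (hP.continuous_forcedFlow N hN f x)
  set g : ℝ → PhaseSpace N := fun s => x + forceRamp N hN f s + ∫ r in (0 : ℝ)..s, P.drift N (z r) with hg
  have hgd : HasDerivAt g (P.drift N (z t) + f • unitP ⟨0, hN⟩) t := by
    have h1 := intervalIntegral.integral_hasDerivAt_right (hYz.intervalIntegrable 0 t)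
      (hYz.stronglyMeasurableAtFilter volume (𝓝 t)) hYz.continuousAt
    have h2 := ((hasDerivAt_forceRamp hN f t).const_add x).add h1
    rw [add_comm (f • unitP ⟨0, hN⟩)] at h2
    exact h2
  refine hgd.congr_of_eventuallyEq ?_
  filter_upwards [Icc_mem_nhds ht (lt_add_one t)] with s hs
  exact hP.forcedFlow_eq_integral N hN f x hs.1

/-! ### The tilted energy and its dissipation -/

/-- `DH(y)·∂_{p_i} = p_i`. [folklore] -/
theorem fderiv_hamiltonian_unitP (y : PhaseSpace N) (i : Fin N) :
    fderiv ℝ (P.hamiltonian N) y (unitP i) = y.2 i := by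
  rw [P.fderiv_hamiltonian_apply (hP.differentiable_hamiltonian N)]
  simp [unitP, Pi.single_apply]

/-- **The tilted-energy derivative along the forced flow**: for `H_f = H - f q_0`,
`(H_f∘φ)'(t) = -γ ∑ w_i p_i(t)²` (`t > 0`): the work of the constant force cancels.
[cite: CuneoEckmannHairerReyBellet2018, §5 eq. (5.2)] -/
theorem hasDerivAt_tilted_forcedFlow (x : PhaseSpace N) {t : ℝ} (ht : 0 < t) :
    HasDerivAt (fun s => P.hamiltonian N (drivenFlow (P.drift N) x (forceRamp N hN f) s) -
        f * (drivenFlow (P.drift N) x (forceRamp N hN f) s).1 ⟨0, hN⟩)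
      (-(P.γ * ∑ i, bathWeight N i * (drivenFlow (P.drift N) x (forceRamp N hN f) t).2 i ^ 2)) t := by
  set z := drivenFlow (P.drift N) x (forceRamp N hN f) with hz
  have hH := hP.differentiable_hamiltonian N
  have hzd := hP.hasDerivAt_forcedFlow N hN f x ht
  have h1 := ((hH _).hasFDerivAt).comp_hasDerivAt t hzd
  rw [map_add, P.fderiv_hamiltonian_drift_self hH, map_smul, hP.fderiv_hamiltonian_unitP N, smul_eq_mul] at h1
  -- the coordinate `q_0` along the flow
  let L : PhaseSpace N →L[ℝ] ℝ :=
    (ContinuousLinearMap.proj ⟨0, hN⟩).comp (ContinuousLinearMap.fst ℝ (Fin N → ℝ) (Fin N → ℝ))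
  have hL : ∀ v : PhaseSpace N, L v = v.1 ⟨0, hN⟩ := fun v => rfl
  have h2 := L.hasFDerivAt.comp_hasDerivAt t hzd
  have h2' : HasDerivAt (fun s => (z s).1 ⟨0, hN⟩) ((z t).2 ⟨0, hN⟩) t := by
    have e : L (P.drift N (z t) + f • unitP ⟨0, hN⟩) = (z t).2 ⟨0, hN⟩ := by
      rw [hL]
      simp [OscillatorChain.drift, unitP]
    rw [e] at h2
    exact h2
  have h3 := h1.sub (h2'.const_mul f)
  exact h3.congr_deriv (by ring)

/-- **The tilted energy identity of the forced flow**: `H_f(φ_t x) = H_f(x) - γ∫₀ᵗ ∑ w_i p_i(s)² ds`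
(`t ≥ 0`). [cite: CuneoEckmannHairerReyBellet2018, §5 eq. (5.2)] -/
theorem tilted_forcedFlow_eq (x : PhaseSpace N) {t : ℝ} (ht : 0 ≤ t) :
    P.hamiltonian N (drivenFlow (P.drift N) x (forceRamp N hN f) t) -
        f * (drivenFlow (P.drift N) x (forceRamp N hN f) t).1 ⟨0, hN⟩ =
      (P.hamiltonian N x - f * x.1 ⟨0, hN⟩) -
        P.γ * ∫ s in (0 : ℝ)..t, ∑ i, bathWeight N i * (drivenFlow (P.drift N) x (forceRamp N hN f) s).2 i ^ 2 := by
  set z := drivenFlow (P.drift N) x (forceRamp N hN f) with hz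
  have hzc : Continuous z := hP.continuous_forcedFlow N hN f x
  have hDc : Continuous fun s => ∑ i, bathWeight N i * (z s).2 i ^ 2 :=
    continuous_finsetSum _ fun i _ =>
      continuous_const.mul (((continuous_apply i).comp (continuous_snd.comp hzc)).pow 2)
  have hf'c : Continuous fun s => -(P.γ * ∑ i, bathWeight N i * (z s).2 i ^ 2) :=
    (continuous_const.mul hDc).neg
  have hHc : Continuous fun s => P.hamiltonian N (z s) - f * (z s).1 ⟨0, hN⟩ :=
    ((P.continuous_hamiltonian hP.contDiff_U.continuous hP.contDiff_V.continuous N).comp hzc).sub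
      (continuous_const.mul ((continuous_apply _).comp (continuous_fst.comp hzc)))
  have hftc := intervalIntegral.integral_eq_sub_of_hasDeriv_right_of_le ht hHc.continuousOn
    (fun s hs => (hP.hasDerivAt_tilted_forcedFlow N hN f x hs.1).hasDerivWithinAt)
    (hf'c.intervalIntegrable 0 t)
  have hz0 : z 0 = x := hP.forcedFlow_zero N hN f x
  rw [intervalIntegral.integral_neg, intervalIntegral.integral_const_mul, hz0] at hftc
  linarith

/-- The tilted energy does not increase along the forced flow (all `t`). [folklore] -/
theorem tilted_forcedFlow_le (x : PhaseSpace N) (t : ℝ) :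
    P.hamiltonian N (drivenFlow (P.drift N) x (forceRamp N hN f) t) -
        f * (drivenFlow (P.drift N) x (forceRamp N hN f) t).1 ⟨0, hN⟩ ≤
      P.hamiltonian N x - f * x.1 ⟨0, hN⟩ := by
  rcases le_or_gt t 0 with ht | ht
  · rw [hP.forcedFlow_of_nonpos N hN f x ht]
  · rw [hP.tilted_forcedFlow_eq N hN f x ht.le]
    have h : 0 ≤ ∫ s in (0 : ℝ)..t, ∑ i, bathWeight N i * (drivenFlow (P.drift N) x (forceRamp N hN f) s).2 i ^ 2 :=
      intervalIntegral.integral_nonneg ht.le fun s _ => dissipationDensity_nonneg N _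
    nlinarith [hP.γ_nonneg]

/-- The tilted energy along the forced flow is nonincreasing in time. [folklore] -/
theorem antitone_tilted_forcedFlow (x : PhaseSpace N) :
    Antitone fun t => P.hamiltonian N (drivenFlow (P.drift N) x (forceRamp N hN f) t) -
      f * (drivenFlow (P.drift N) x (forceRamp N hN f) t).1 ⟨0, hN⟩ := by
  intro a b hab
  simp only
  rcases le_or_gt a 0 with ha | ha
  · rw [hP.forcedFlow_of_nonpos N hN f x ha]
    exact hP.tilted_forcedFlow_le N hN f x b
  · have h := hP.forcedFlow_add N hN f x ha.le (sub_nonneg.2 hab)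
    rw [add_sub_cancel] at h
    rw [h]
    exact hP.tilted_forcedFlow_le N hN f _ _

end Flow

/-! ### Coercivity of the tilted energy, convergence, cluster points -/

section Coercive

variable (hP : P.IsConfining) (N : ℕ) (hN : 0 < N) (f : ℝ) {Cf : ℝ}
  (hdom : ∀ y : PhaseSpace N, |f * y.1 ⟨0, hN⟩| ≤ P.hamiltonian N y / 2 + Cf)
include hP hdom

omit hP in
/-- The tilted energy dominates half the energy: `H/2 - C_f ≤ H_f`. [folklore] -/
theorem half_hamiltonian_le_tilted (y : PhaseSpace N) :
    P.hamiltonian N y / 2 - Cf ≤ P.hamiltonian N y - f * y.1 ⟨0, hN⟩ := by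
  have h := hdom y
  have h2 := le_abs_self (f * y.1 ⟨0, hN⟩)
  linarith

/-- The tilted energy is bounded below by `-C_f`. [folklore] -/
theorem neg_le_tilted (y : PhaseSpace N) : -Cf ≤ P.hamiltonian N y - f * y.1 ⟨0, hN⟩ := by
  have h := half_hamiltonian_le_tilted N hN f hdom y
  have h0 := hP.hamiltonian_nonneg N y
  linarith

/-- The sublevel sets of the tilted energy are compact. [folklore] -/
theorem isCompact_setOf_tilted_le (E : ℝ) :
    IsCompact {y : PhaseSpace N | P.hamiltonian N y - f * y.1 ⟨0, hN⟩ ≤ E} := by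
  have hHc := P.continuous_hamiltonian hP.contDiff_U.continuous hP.contDiff_V.continuous N
  have hclosed : IsClosed {y : PhaseSpace N | P.hamiltonian N y - f * y.1 ⟨0, hN⟩ ≤ E} :=
    isClosed_le (hHc.sub (continuous_const.mul ((continuous_apply _).comp continuous_fst))) continuous_const
  refine (hP.isCompact_setOf_hamiltonian_le N (2 * (E + Cf))).of_isClosed_subset hclosed fun y hy => ?_
  have h := half_hamiltonian_le_tilted N hN f hdom y
  have hy' : P.hamiltonian N y - f * y.1 ⟨0, hN⟩ ≤ E := hy
  show P.hamiltonian N y ≤ 2 * (E + Cf)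
  linarith

/-- The tilted energy along the forced flow converges as `t → ∞`. [folklore] -/
theorem exists_tendsto_tilted_forcedFlow (x : PhaseSpace N) :
    ∃ Einf : ℝ, Tendsto (fun t => P.hamiltonian N (drivenFlow (P.drift N) x (forceRamp N hN f) t) -
      f * (drivenFlow (P.drift N) x (forceRamp N hN f) t).1 ⟨0, hN⟩) atTop (𝓝 Einf) := by
  refine ⟨_, tendsto_atTop_ciInf (hP.antitone_tilted_forcedFlow N hN f x) ⟨-Cf, ?_⟩⟩
  rintro _ ⟨t, rfl⟩
  exact hP.neg_le_tilted N hN f hdom _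

omit hdom in
/-- The forced orbit stays in the compact sublevel set `{H_f ≤ H_f(x)}`. [folklore] -/
theorem forcedFlow_mem_sublevel (x : PhaseSpace N) (t : ℝ) :
    drivenFlow (P.drift N) x (forceRamp N hN f) t ∈
      {y : PhaseSpace N | P.hamiltonian N y - f * y.1 ⟨0, hN⟩ ≤ P.hamiltonian N x - f * x.1 ⟨0, hN⟩} :=
  hP.tilted_forcedFlow_le N hN f x t

/-- **At a cluster point of the forced orbit the tilted energy is stationary**: if `w` is a cluster
point of `t ↦ φ_t(x)` at `+∞` then `H_f(φ_s w) = H_f(w)` for every `s ≥ 0`. [folklore] -/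
theorem tilted_forcedFlow_eq_of_mapClusterPt (x : PhaseSpace N) {w : PhaseSpace N}
    (hw : MapClusterPt w atTop (drivenFlow (P.drift N) x (forceRamp N hN f))) {s : ℝ} (hs : 0 ≤ s) :
    P.hamiltonian N (drivenFlow (P.drift N) w (forceRamp N hN f) s) -
        f * (drivenFlow (P.drift N) w (forceRamp N hN f) s).1 ⟨0, hN⟩ =
      P.hamiltonian N w - f * w.1 ⟨0, hN⟩ := by
  obtain ⟨Einf, hE⟩ := hP.exists_tendsto_tilted_forcedFlow N hN f hdom x
  have hHc := P.continuous_hamiltonian hP.contDiff_U.continuous hP.contDiff_V.continuous N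
  set Hf : PhaseSpace N → ℝ := fun y => P.hamiltonian N y - f * y.1 ⟨0, hN⟩ with hHf
  have hHfc : Continuous Hf := hHc.sub (continuous_const.mul ((continuous_apply _).comp continuous_fst))
  have hcont : ∀ r : ℝ, Continuous fun y => Hf (drivenFlow (P.drift N) y (forceRamp N hN f) r) := fun r =>
    hHfc.comp (hP.continuous_forcedFlow_left N hN f r)
  have hval : ∀ r : ℝ, 0 ≤ r → Hf (drivenFlow (P.drift N) w (forceRamp N hN f) r) = Einf := by
    intro r hr
    have hcl : MapClusterPt (Hf (drivenFlow (P.drift N) w (forceRamp N hN f) r)) atTop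
        ((fun y => Hf (drivenFlow (P.drift N) y (forceRamp N hN f) r)) ∘ drivenFlow (P.drift N) x (forceRamp N hN f)) :=
      MapClusterPt.continuousAt_comp (f := fun y => Hf (drivenFlow (P.drift N) y (forceRamp N hN f) r))
        (hcont r).continuousAt hw
    have heq : ((fun y => Hf (drivenFlow (P.drift N) y (forceRamp N hN f) r)) ∘ drivenFlow (P.drift N) x (forceRamp N hN f))
        =ᶠ[atTop] fun t => Hf (drivenFlow (P.drift N) x (forceRamp N hN f) (t + r)) := by
      filter_upwards [eventually_ge_atTop 0] with t ht
      simp only [Function.comp_apply]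
      rw [hP.forcedFlow_add N hN f x ht hr]
    have hlim : Tendsto (fun t => Hf (drivenFlow (P.drift N) x (forceRamp N hN f) (t + r))) atTop (𝓝 Einf) :=
      hE.comp (tendsto_atTop_add_const_right atTop r tendsto_id)
    exact t2_iff_nhds.1 inferInstance (((hcl.congrFun heq).clusterPt).mono hlim)
  have h0 := hval 0 le_rfl
  rw [hP.forcedFlow_zero N hN f w] at h0
  have h1 := hval s hs
  simp only [hHf] at h0 h1
  rw [h1, ← h0]

omit hdom in
/-- **If the tilted energy is stationary along the forced flow and `γ > 0`, the bath momenta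
vanish identically** at every site with `w_i ≠ 0`. [folklore] -/
theorem momentum_eq_zero_of_tilted_const (hγ : 0 < P.γ) (w : PhaseSpace N)
    (h : ∀ s, 0 ≤ s → P.hamiltonian N (drivenFlow (P.drift N) w (forceRamp N hN f) s) -
        f * (drivenFlow (P.drift N) w (forceRamp N hN f) s).1 ⟨0, hN⟩ =
      P.hamiltonian N w - f * w.1 ⟨0, hN⟩)
    (i : Fin N) (hi : bathWeight N i ≠ 0) :
    ∀ s, 0 ≤ s → (drivenFlow (P.drift N) w (forceRamp N hN f) s).2 i = 0 := by
  set D : ℝ → ℝ := fun r => ∑ j, bathWeight N j * (drivenFlow (P.drift N) w (forceRamp N hN f) r).2 j ^ 2 with hD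
  have hzc := hP.continuous_forcedFlow N hN f w
  have hDc : Continuous D :=
    continuous_finsetSum _ fun j _ =>
      continuous_const.mul (((continuous_apply j).comp (continuous_snd.comp hzc)).pow 2)
  have hint : ∀ t, 0 ≤ t → ∫ s in (0 : ℝ)..t, D s = 0 := by
    intro t ht
    have h1 := hP.tilted_forcedFlow_eq N hN f w ht
    rw [h t ht] at h1
    have h2 : P.γ * ∫ s in (0 : ℝ)..t, D s = 0 := by linarith
    exact (mul_eq_zero.1 h2).resolve_left hγ.ne'
  have hD0 := eq_zero_of_intervalIntegral_eq_zero hDc hint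
  intro s hs
  have hterm := (Finset.sum_eq_zero_iff_of_nonneg fun j _ =>
    mul_nonneg (bathWeight_nonneg N j) (sq_nonneg _)).1 (hD0 s hs) i (Finset.mem_univ i)
  rcases mul_eq_zero.1 hterm with h3 | h3
  · exact absurd h3 hi
  · exact pow_eq_zero_iff (n := 2) two_ne_zero |>.1 h3

end Coercive

/-! ### The component equations of the forced flow -/

section Components

variable (hP : P.IsConfining) (N : ℕ) (hN : 0 < N) (f : ℝ)
include hP

/-- **Position components of the forced integral equation**: `q_i(t) = q_i(0) + ∫₀ᵗ p_i` (the
ramp has no position component). [folklore] -/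
theorem forcedFlow_fst_eq (x : PhaseSpace N) (i : Fin N) {t : ℝ} (ht : 0 ≤ t) :
    (drivenFlow (P.drift N) x (forceRamp N hN f) t).1 i =
      x.1 i + ∫ s in (0 : ℝ)..t, (drivenFlow (P.drift N) x (forceRamp N hN f) s).2 i := by
  set z := drivenFlow (P.drift N) x (forceRamp N hN f) with hz
  have hF : IntervalIntegrable (fun s => P.drift N (z s)) volume 0 t :=
    ((hP.continuous_drift N).comp (hP.continuous_forcedFlow N hN f x)).intervalIntegrable 0 t
  have h := hP.forcedFlow_eq_integral N hN f x ht
  have hcomp := ((ContinuousLinearMap.proj (R := ℝ) i).comp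
    (ContinuousLinearMap.fst ℝ (Fin N → ℝ) (Fin N → ℝ))).intervalIntegral_comp_comm hF
  have h1 : (z t).1 i = x.1 i + ((∫ s in (0 : ℝ)..t, P.drift N (z s)).1) i := by
    show (drivenFlow (P.drift N) x (forceRamp N hN f) t).1 i = _
    rw [h, Prod.fst_add, Prod.fst_add, forceRamp_fst, Pi.add_apply, Pi.add_apply, Pi.zero_apply,
      add_zero]
  rw [h1]
  congr 1
  simp only [ContinuousLinearMap.coe_comp, ContinuousLinearMap.coe_fst', Function.comp_apply,
    ContinuousLinearMap.proj_apply] at hcomp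
  rw [← hcomp]
  refine intervalIntegral.integral_congr fun s _ => ?_
  rw [hP.drift_apply N]

/-- **Momentum components of the forced integral equation**:
`p_i(t) = p_i(0) + [i = 0] f t + ∫₀ᵗ (-∂_iΦ(q) - γ w_i p_i)`. [folklore] -/
theorem forcedFlow_snd_eq (x : PhaseSpace N) (i : Fin N) {t : ℝ} (ht : 0 ≤ t) :
    (drivenFlow (P.drift N) x (forceRamp N hN f) t).2 i =
      x.2 i + (if i = ⟨0, hN⟩ then f * t else 0) + ∫ s in (0 : ℝ)..t,
        (-P.dPotential N i (drivenFlow (P.drift N) x (forceRamp N hN f) s).1 -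
          P.γ * bathWeight N i * (drivenFlow (P.drift N) x (forceRamp N hN f) s).2 i) := by
  set z := drivenFlow (P.drift N) x (forceRamp N hN f) with hz
  have hF : IntervalIntegrable (fun s => P.drift N (z s)) volume 0 t :=
    ((hP.continuous_drift N).comp (hP.continuous_forcedFlow N hN f x)).intervalIntegrable 0 t
  have h := hP.forcedFlow_eq_integral N hN f x ht
  have hcomp := ((ContinuousLinearMap.proj (R := ℝ) i).comp
    (ContinuousLinearMap.snd ℝ (Fin N → ℝ) (Fin N → ℝ))).intervalIntegral_comp_comm hF
  have h1 : (z t).2 i = x.2 i + (if i = ⟨0, hN⟩ then f * t else 0) +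
      ((∫ s in (0 : ℝ)..t, P.drift N (z s)).2) i := by
    show (drivenFlow (P.drift N) x (forceRamp N hN f) t).2 i = _
    rw [h, Prod.snd_add, Prod.snd_add, Pi.add_apply, Pi.add_apply, forceRamp_snd_apply]
  rw [h1]
  congr 1
  simp only [ContinuousLinearMap.coe_comp, ContinuousLinearMap.coe_snd', Function.comp_apply,
    ContinuousLinearMap.proj_apply] at hcomp
  rw [← hcomp]
  refine intervalIntegral.integral_congr fun s _ => ?_
  rw [hP.drift_apply N]

/-- Along the forced flow, a momentum that vanishes identically freezes its position. [folklore] -/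
theorem forcedFlow_fst_const_of_snd_eq_zero (x : PhaseSpace N) (i : Fin N)
    (hp : ∀ t, 0 ≤ t → (drivenFlow (P.drift N) x (forceRamp N hN f) t).2 i = 0) :
    ∀ t, 0 ≤ t → (drivenFlow (P.drift N) x (forceRamp N hN f) t).1 i = x.1 i := by
  intro t ht
  rw [hP.forcedFlow_fst_eq N hN f x i ht]
  have : ∫ s in (0 : ℝ)..t, (drivenFlow (P.drift N) x (forceRamp N hN f) s).2 i = ∫ _ in (0 : ℝ)..t, (0 : ℝ) := by
    refine intervalIntegral.integral_congr fun s hs => ?_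
    rw [uIcc_of_le ht] at hs
    exact hp s hs.1
  rw [this]
  simp

/-- Along the forced flow, a momentum that vanishes identically at an UNFORCED site (`i ≠ 0`) makes
the force on its site vanish: `p_i ≡ 0 ⟹ ∂_iΦ(q(t)) = 0`. [folklore] -/
theorem dPotential_eq_zero_of_forcedFlow_snd_eq_zero (x : PhaseSpace N) (i : Fin N) (hi : i ≠ ⟨0, hN⟩)
    (hp : ∀ t, 0 ≤ t → (drivenFlow (P.drift N) x (forceRamp N hN f) t).2 i = 0) :
    ∀ t, 0 ≤ t → P.dPotential N i (drivenFlow (P.drift N) x (forceRamp N hN f) t).1 = 0 := by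
  have hzc := hP.continuous_forcedFlow N hN f x
  have h21 : (2 : WithTop ℕ∞) = 1 + 1 := by norm_num
  have hFc : Continuous fun s => P.dPotential N i (drivenFlow (P.drift N) x (forceRamp N hN f) s).1 :=
    (P.contDiff_dPotential_of_succ (h21 ▸ hP.contDiff_U) (h21 ▸ hP.contDiff_V) N i).continuous.comp
      (continuous_fst.comp hzc)
  have hx0 : x.2 i = 0 := by
    have h0 := hp 0 le_rfl
    rwa [hP.forcedFlow_zero N hN f x] at h0
  refine eq_zero_of_intervalIntegral_eq_zero hFc fun t ht => ?_
  have h1 := hP.forcedFlow_snd_eq N hN f x i ht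
  rw [hp t ht, hx0, if_neg hi] at h1
  have h2 : ∫ s in (0 : ℝ)..t, (-P.dPotential N i (drivenFlow (P.drift N) x (forceRamp N hN f) s).1 -
      P.γ * bathWeight N i * (drivenFlow (P.drift N) x (forceRamp N hN f) s).2 i) =
      ∫ s in (0 : ℝ)..t, -P.dPotential N i (drivenFlow (P.drift N) x (forceRamp N hN f) s).1 := by
    refine intervalIntegral.integral_congr fun s hs => ?_
    rw [uIcc_of_le ht] at hs
    rw [hp s hs.1]
    ring
  rw [h2, intervalIntegral.integral_neg] at h1
  linarith

/-- Along the forced flow, if the momentum of the FORCED site `0` vanishes identically then the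
potential force there balances the pull: `p_0 ≡ 0 ⟹ ∂_0Φ(q(t)) = f`. [folklore] -/
theorem dPotential_eq_force_of_forcedFlow_snd_eq_zero (x : PhaseSpace N)
    (hp : ∀ t, 0 ≤ t → (drivenFlow (P.drift N) x (forceRamp N hN f) t).2 ⟨0, hN⟩ = 0) :
    ∀ t, 0 ≤ t → P.dPotential N ⟨0, hN⟩ (drivenFlow (P.drift N) x (forceRamp N hN f) t).1 = f := by
  have hzc := hP.continuous_forcedFlow N hN f x
  have h21 : (2 : WithTop ℕ∞) = 1 + 1 := by norm_num
  have hFc : Continuous fun s => f - P.dPotential N ⟨0, hN⟩ (drivenFlow (P.drift N) x (forceRamp N hN f) s).1 :=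
    continuous_const.sub
      ((P.contDiff_dPotential_of_succ (h21 ▸ hP.contDiff_U) (h21 ▸ hP.contDiff_V) N ⟨0, hN⟩).continuous.comp
        (continuous_fst.comp hzc))
  have hx0 : x.2 ⟨0, hN⟩ = 0 := by
    have h0 := hp 0 le_rfl
    rwa [hP.forcedFlow_zero N hN f x] at h0
  have hDc : Continuous fun s => P.dPotential N ⟨0, hN⟩ (drivenFlow (P.drift N) x (forceRamp N hN f) s).1 :=
    (P.contDiff_dPotential_of_succ (h21 ▸ hP.contDiff_U) (h21 ▸ hP.contDiff_V) N ⟨0, hN⟩).continuous.comp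
      (continuous_fst.comp hzc)
  have key := eq_zero_of_intervalIntegral_eq_zero hFc fun t ht => by
    have h1 := hP.forcedFlow_snd_eq N hN f x ⟨0, hN⟩ ht
    rw [hp t ht, hx0, if_pos rfl] at h1
    have hI : ∫ s in (0 : ℝ)..t, (-P.dPotential N ⟨0, hN⟩ (drivenFlow (P.drift N) x (forceRamp N hN f) s).1 -
        P.γ * bathWeight N ⟨0, hN⟩ * (drivenFlow (P.drift N) x (forceRamp N hN f) s).2 ⟨0, hN⟩) =
        -∫ s in (0 : ℝ)..t, P.dPotential N ⟨0, hN⟩ (drivenFlow (P.drift N) x (forceRamp N hN f) s).1 := by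
      rw [← intervalIntegral.integral_neg]
      refine intervalIntegral.integral_congr fun s hs => ?_
      rw [uIcc_of_le ht] at hs
      rw [hp s hs.1]
      ring
    have hJ : ∫ s in (0 : ℝ)..t, (f - P.dPotential N ⟨0, hN⟩ (drivenFlow (P.drift N) x (forceRamp N hN f) s).1) =
        f * t - ∫ s in (0 : ℝ)..t, P.dPotential N ⟨0, hN⟩ (drivenFlow (P.drift N) x (forceRamp N hN f) s).1 := by
      rw [intervalIntegral.integral_sub intervalIntegrable_const (hDc.intervalIntegrable _ _),
        intervalIntegral.integral_const, sub_zero, smul_eq_mul, mul_comm]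
    rw [hI] at h1
    rw [hJ]
    linarith
  intro t ht
  have := key t ht
  linarith

/-! ### Rigidity: a motionless right end freezes the forced chain at a forced rest point -/

/-- **Rigidity for the forced chain**: for a confining chain with injective interaction force
`V'`, if along the forced flow started at `w` the momentum of the last site vanishes for all
times, then `w` is a forced rest point: `p = 0`, `∂_iΦ(q) = 0` for `i ≠ 0` and `∂_0Φ(q) = f`
(`N ≥ 1`; peeling from the right as in `eq_zero_of_momentum_last_eq_zero`).
[cite: CuneoEckmannHairerReyBellet2018, Prop 3.3] -/
theorem forced_rest_of_momentum_last_eq_zero (hVinj : Function.Injective (deriv P.V)) (w : PhaseSpace N)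
    (h : ∀ t, 0 ≤ t → (drivenFlow (P.drift N) w (forceRamp N hN f) t).2 ⟨N - 1, by omega⟩ = 0) :
    w.2 = 0 ∧ (∀ i : Fin N, i ≠ ⟨0, hN⟩ → P.dPotential N i w.1 = 0) ∧ P.dPotential N ⟨0, hN⟩ w.1 = f := by
  have hzc : Continuous (drivenFlow (P.drift N) w (forceRamp N hN f)) := hP.continuous_forcedFlow N hN f w
  have hz0 : drivenFlow (P.drift N) w (forceRamp N hN f) 0 = w := hP.forcedFlow_zero N hN f w
  -- peeling induction on the number `k` of frozen sites from the right
  have hpeel : ∀ k, k ≤ N → ∀ i : Fin N, N - k ≤ i.val →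
      ∀ t, 0 ≤ t → (drivenFlow (P.drift N) w (forceRamp N hN f) t).2 i = 0 := by
    intro k
    induction k with
    | zero =>
      intro _ i hi
      exact absurd i.isLt (by omega)
    | succ k ih =>
      intro hk i hi
      by_cases hi' : N - k ≤ i.val
      · exact ih (by omega) i hi'
      · have hieq : i.val = N - (k + 1) := by omega
        rcases Nat.eq_zero_or_pos k with hk0 | hkpos
        · subst hk0
          have hiN : i = ⟨N - 1, by omega⟩ := Fin.ext (by simpa using hieq)
          intro t ht
          rw [hiN]
          exact h t ht
        · have hi₁ : i.val + 1 < N := by omega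
          have hne₁ : (⟨i.val + 1, hi₁⟩ : Fin N) ≠ ⟨0, hN⟩ := fun e => by
            have := congrArg Fin.val e; simp at this
          have hp₁ : ∀ t, 0 ≤ t → (drivenFlow (P.drift N) w (forceRamp N hN f) t).2 ⟨i.val + 1, hi₁⟩ = 0 :=
            ih (by omega) ⟨i.val + 1, hi₁⟩ (by simp only; omega)
          have hq₁ := hP.forcedFlow_fst_const_of_snd_eq_zero N hN f w ⟨i.val + 1, hi₁⟩ hp₁
          have hF₁ := hP.dPotential_eq_zero_of_forcedFlow_snd_eq_zero N hN f w ⟨i.val + 1, hi₁⟩ hne₁ hp₁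
          have hq₂ : ∀ (h2 : i.val + 1 + 1 < N) (t : ℝ), 0 ≤ t →
              (drivenFlow (P.drift N) w (forceRamp N hN f) t).1 ⟨i.val + 1 + 1, h2⟩ = w.1 ⟨i.val + 1 + 1, h2⟩ :=
            fun h2 => hP.forcedFlow_fst_const_of_snd_eq_zero N hN f w ⟨i.val + 1 + 1, h2⟩
              (ih (by omega) ⟨i.val + 1 + 1, h2⟩ (by simp only; omega))
          -- the interaction force on the bond `(i, i+1)` is frozen
          have hV : ∀ t, 0 ≤ t →
              deriv P.V (w.1 ⟨i.val + 1, hi₁⟩ - (drivenFlow (P.drift N) w (forceRamp N hN f) t).1 i) =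
                -deriv P.U (w.1 ⟨i.val + 1, hi₁⟩) +
                  (if h2 : i.val + 1 + 1 < N then
                    deriv P.V (w.1 ⟨i.val + 1 + 1, h2⟩ - w.1 ⟨i.val + 1, hi₁⟩) else 0) := by
            intro t ht
            have e := hF₁ t ht
            rw [P.dPotential_succ_eq N i hi₁, hq₁ t ht] at e
            by_cases h2 : i.val + 1 + 1 < N
            · rw [dif_pos h2, hq₂ h2 t ht] at e
              rw [dif_pos h2]
              linarith
            · rw [dif_neg h2] at e
              rw [dif_neg h2]
              linarith
          -- hence `q_i` is frozen
          have hqi : ∀ t, 0 ≤ t → (drivenFlow (P.drift N) w (forceRamp N hN f) t).1 i = w.1 i := by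
            intro t ht
            have e1 := hV t ht
            have e0 := hV 0 le_rfl
            rw [hz0] at e0
            have e2 := hVinj (e1.trans e0.symm)
            linarith
          -- hence `p_i ≡ 0`
          have hpc : Continuous fun s => (drivenFlow (P.drift N) w (forceRamp N hN f) s).2 i :=
            (continuous_apply i).comp (continuous_snd.comp hzc)
          refine eq_zero_of_intervalIntegral_eq_zero hpc fun t ht => ?_
          have e := hP.forcedFlow_fst_eq N hN f w i ht
          rw [hqi t ht] at e
          linarith
  have hall : ∀ i : Fin N, ∀ t, 0 ≤ t → (drivenFlow (P.drift N) w (forceRamp N hN f) t).2 i = 0 :=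
    fun i => hpeel N le_rfl i (by omega)
  have hp0 : w.2 = 0 := by
    funext i
    have := hall i 0 le_rfl
    rwa [hz0] at this
  refine ⟨hp0, fun i hi => ?_, ?_⟩
  · have := hP.dPotential_eq_zero_of_forcedFlow_snd_eq_zero N hN f w i hi (hall i) 0 le_rfl
    rwa [hz0] at this
  · have := hP.dPotential_eq_force_of_forcedFlow_snd_eq_zero N hN f w (hall ⟨0, hN⟩) 0 le_rfl
    rwa [hz0] at this

end Components

/-! ### LaSalle: the forced chain relaxes to the forced rest point -/

section LaSalle

variable (hP : P.IsConfining) (N : ℕ) (hN : 0 < N) (f : ℝ) {Cf : ℝ}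
  (hdom : ∀ y : PhaseSpace N, |f * y.1 ⟨0, hN⟩| ≤ P.hamiltonian N y / 2 + Cf)
  (hγ : 0 < P.γ) (hVinj : Function.Injective (deriv P.V)) {qstar : Fin N → ℝ}
  (huniq : ∀ q : Fin N → ℝ, (∀ i : Fin N, i ≠ ⟨0, hN⟩ → P.dPotential N i q = 0) →
    P.dPotential N ⟨0, hN⟩ q = f → q = qstar)
include hP hdom hγ hVinj huniq

/-- **LaSalle's invariance principle for the damped confining chain pulled at its left end**
(`γ > 0`, `N ≥ 1`, `V'` injective, the tilted energy coercive, and the forced rest configuration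
`q⋆` UNIQUE): every trajectory of the forced undriven chain converges to `x⋆ = (q⋆, 0)`. The orbit
lies in the compact set `{H_f ≤ H_f(x)}`; at a cluster point `w ≠ x⋆` the tilted energy would be
stationary along `φ(w)`, so the momentum of the last (bath) site would vanish identically, so
`w = x⋆` by rigidity and uniqueness. [cite: CuneoEckmannHairerReyBellet2018, Prop 3.3] -/
theorem tendsto_forcedFlow (x : PhaseSpace N) :
    Tendsto (drivenFlow (P.drift N) x (forceRamp N hN f)) atTop (𝓝 ((qstar, 0) : PhaseSpace N)) := by
  by_contra hnot
  obtain ⟨U, hU, hfreq⟩ := not_tendsto_iff_exists_frequently_notMem.1 hnot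
  obtain ⟨V, hVU, hVopen, h0V⟩ := _root_.mem_nhds_iff.1 hU
  set K : Set (PhaseSpace N) := {y | P.hamiltonian N y - f * y.1 ⟨0, hN⟩ ≤
      P.hamiltonian N x - f * x.1 ⟨0, hN⟩} ∩ Vᶜ with hK
  have hKc : IsCompact K :=
    (hP.isCompact_setOf_tilted_le N hN f hdom _).inter_right hVopen.isClosed_compl
  have hfreqK : ∃ᶠ t in atTop, drivenFlow (P.drift N) x (forceRamp N hN f) t ∈ K := by
    refine (hfreq.and_eventually (Eventually.of_forall fun t =>
      hP.forcedFlow_mem_sublevel N hN f x t)).mono fun t ht => ?_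
    exact ⟨ht.2, fun hV => ht.1 (hVU hV)⟩
  obtain ⟨w, hwK, hw⟩ := hKc.exists_mapClusterPt_of_frequently hfreqK
  have hconst : ∀ s, 0 ≤ s → P.hamiltonian N (drivenFlow (P.drift N) w (forceRamp N hN f) s) -
      f * (drivenFlow (P.drift N) w (forceRamp N hN f) s).1 ⟨0, hN⟩ = P.hamiltonian N w - f * w.1 ⟨0, hN⟩ :=
    fun s hs => hP.tilted_forcedFlow_eq_of_mapClusterPt N hN f hdom x hw hs
  have hlast := hP.momentum_eq_zero_of_tilted_const N hN f hγ w hconst ⟨N - 1, by omega⟩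
    (bathWeight_last_ne_zero N hN)
  obtain ⟨hp0, hrest, hforce⟩ := hP.forced_rest_of_momentum_last_eq_zero N hN f hVinj w hlast
  have hw0 : w = ((qstar, 0) : PhaseSpace N) := Prod.ext (huniq w.1 hrest hforce) hp0
  exact hwK.2 (hw0 ▸ h0V)

end LaSalle

/-! ### Irreducibility of the transition kernels towards the forced rest point -/

section Irreducible

variable (hP : P.IsConfining) (N : ℕ) (hN : 0 < N) (f : ℝ) {Cf : ℝ}
  (hdom : ∀ y : PhaseSpace N, |f * y.1 ⟨0, hN⟩| ≤ P.hamiltonian N y / 2 + Cf)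
  (hγ : 0 < P.γ) (hVinj : Function.Injective (deriv P.V)) {qstar : Fin N → ℝ}
  (huniq : ∀ q : Fin N → ℝ, (∀ i : Fin N, i ≠ ⟨0, hN⟩ → P.dPotential N i q = 0) →
    P.dPotential N ⟨0, hN⟩ q = f → q = qstar)
  {T_L : ℝ} (hTL : 0 < T_L) (T_R : ℝ)
include hP hdom hγ hVinj huniq hTL

omit hP hdom hVinj huniq in
/-- The ramp is the control noise path of the linear control `s ↦ (f/√(2γT_L)) s` on the left
bath and no control on the right bath. [folklore] -/
theorem controlPath_eq_forceRamp :
    controlPath (P.bathVecL N T_L) (P.bathVecR N T_R) (fun s => f / Real.sqrt (2 * P.γ * T_L) * s) (fun _ => 0) =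
      forceRamp N hN f := by
  have hσ : Real.sqrt (2 * P.γ * T_L) ≠ 0 := Real.sqrt_ne_zero'.2 (by positivity)
  funext s
  rw [controlPath, zero_smul, add_zero, forceRamp_apply, OscillatorChain.bathVecL,
    bathVec_eq_smul_unitP hN, smul_smul]
  congr 1
  field_simp

/-- **Every neighbourhood of the forced rest point is reached with positive probability at all
large times**, from every initial condition (`T_L > 0`): the ramp control steers every point to
`x⋆` (LaSalle), and the support theorem `ConfinedDrift.sdeKernel_pos_of_flow_mem` applies to the
Lipschitz control `s ↦ (f/√(2γT_L)) s`. [cite: CuneoEckmannHairerReyBellet2018, Prop 3.3 and Cor 3.4] -/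
theorem langevinKernel_pos_of_mem_nhds_forced (z : PhaseSpace N) {G : Set (PhaseSpace N)}
    (hG : G ∈ 𝓝 ((qstar, 0) : PhaseSpace N)) :
    ∃ s₀ : ℝ≥0, ∀ t : ℝ≥0, s₀ ≤ t → 0 < P.langevinKernel N T_L T_R t z G := by
  obtain ⟨G', hG'G, hG'o, hxG'⟩ := _root_.mem_nhds_iff.1 hG
  have htend := hP.tendsto_forcedFlow N hN f hdom hγ hVinj huniq z
  have hev : ∀ᶠ t in atTop, drivenFlow (P.drift N) z (forceRamp N hN f) t ∈ G' :=
    htend (hG'o.mem_nhds hxG')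
  obtain ⟨s₀, hs₀⟩ := eventually_atTop.1 hev
  refine ⟨⟨max s₀ 0, le_max_right _ _⟩, fun t ht => ?_⟩
  have ht' : s₀ ≤ (t : ℝ) := (le_max_left _ _).trans (by exact_mod_cast ht)
  have hmem : drivenFlow (P.drift N) z (controlPath (P.bathVecL N T_L) (P.bathVecR N T_R)
      (fun s => f / Real.sqrt (2 * P.γ * T_L) * s) (fun _ => 0)) t ∈ G' := by
    rw [controlPath_eq_forceRamp N hN f hγ hTL T_R]
    exact hs₀ t ht'
  set L : ℝ := |f / Real.sqrt (2 * P.γ * T_L)| with hL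
  have hpos := (hP.confinedDrift N).toConfinedDrift.sdeKernel_pos_of_flow_mem
    (hP.bathVec_mem_noise N 0 _) (hP.bathVec_mem_noise N (N - 1) _) z
    (f₁ := fun s => f / Real.sqrt (2 * P.γ * T_L) * s) (f₂ := fun _ => 0)
    (continuous_const.mul continuous_id) continuous_const (by simp) rfl (abs_nonneg _ : 0 ≤ L)
    (fun s u _ hsu _ => by
      rw [← mul_sub, abs_mul, abs_of_nonneg (sub_nonneg.2 hsu)])
    (fun s u _ hsu _ => by
      rw [sub_self, abs_zero]; exact mul_nonneg (abs_nonneg _) (sub_nonneg.2 hsu))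
    hG'o hmem
  exact hpos.trans_le (measure_mono hG'G)

/-- **Pointed irreducibility towards the forced rest point** (`∃ t` form, the hypothesis `h_irred`
of `Literature/Probability/Process/SmallSets.lean`). [cite: CuneoEckmannHairerReyBellet2018, Prop 3.3] -/
theorem exists_langevinKernel_pos_of_forced_mem (z : PhaseSpace N) (U : Set (PhaseSpace N)) (hU : IsOpen U)
    (hx : ((qstar, 0) : PhaseSpace N) ∈ U) :
    ∃ t : ℝ≥0, 0 < P.langevinKernel N T_L T_R t z U := by
  obtain ⟨s₀, hs₀⟩ := hP.langevinKernel_pos_of_mem_nhds_forced N hN f hdom hγ hVinj huniq hTL T_R z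
    (hU.mem_nhds hx)
  exact ⟨s₀, hs₀ s₀ le_rfl⟩

end Irreducible

end IsConfining

end OscillatorChain

end Literature.MathematicalPhysics.KineticTheory.HeatConduction

end
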